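import Summits.QuantumFields.YangMills.Theorems.FlatTubeReductionProfileInterfaceMoment
import HarnessLib

/-!
# Glue for the reference-moment machine: level powers and the restriction to the bounded-level set

Support file for the crux `NearFlatRatioLaw` (line `ratepack_v2`, stub `stub_hODpot_A`, step (R3b-iii-a) of
`Cruxes/NearFlatRatioLaw/Lines/ratepack-v7-moments-g18.md` §10).

`…FibreKernelLevelWeight.fpBOKernel_gaugeDev_le_levelWeight` produces `∫ fpTriple β Ω′ (fpWeight ε) 1 1 · (1 + β·kin + β‖x‖² + β‖x′‖²)^j`
over the whole fibre product space, while `RateTube.profile_moment_number` consumes the fourth power over the bounded-level set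
`{β·kin ≤ T} ∩ {β‖x‖² ≤ T} ∩ {β‖x′‖² ≤ T} ∩ {Ω′(x) ≠ 0 ∧ Ω′(x′) ≠ 0 ∧ fpWeight ≠ 0}`.  Since the level is `≥ 1`, `(level)^j ≤ (level)^4`
for `j ≤ 4`; since `kinDefect ≤ 4|E|` always (`kinDefect_le_four_card`) and `Ω′` lives on `‖x‖ ≤ R`, the integrand vanishes off the
bounded-level set for `T ≥ β(4|E|)`, `T ≥ βR²`: `integral_levelWeight_pow_le_setIntegral_four`.
-/

noncomputable section

open MeasureTheory Filter Topology Real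
open scoped BigOperators
open Literature.MathematicalPhysics.QuantumFieldTheory
open Literature.MathematicalPhysics.QuantumLattice

namespace Summit.QuantumFields.YangMills.Theorems.FemtoTransferGap.TwoLattice.ConstTube

open Summit.QuantumFields.YangMills.Theorems.FemtoTransferGap
open Summit.QuantumFields.YangMills.Theorems.FemtoTransferGap.TwoLattice
open Summit.QuantumFields.YangMills.Theorems.FemtoTransferGap.TwoLattice.Avg
open Summit.QuantumFields.YangMills.Theorems.FemtoTransferGap.TwoLattice.Stiff (LinkSpace)

variable {L : ℕ} [NeZero L]

/-- **`kinDefect ≤ 4|E|`**: each summand is the squared norm of a difference of two unit quaternions. [folklore] -/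
theorem kinDefect_le_four_card (U V : GaugeConfig 3 L SU2) (g : Site 3 L → SU2) : kinDefect L U V g ≤ 4 * Fintype.card (Edge 3 L) := by
  unfold kinDefect
  have h : ∀ e : Edge 3 L, ‖su2Quat (U e) * su2Quat (g (e.1.shift e.2)) - su2Quat (g e.1) * su2Quat (V e)‖ ^ 2 ≤ 4 := fun e => by
    have h1 : ‖su2Quat (U e) * su2Quat (g (e.1.shift e.2)) - su2Quat (g e.1) * su2Quat (V e)‖ ≤ 2 := by
      refine (norm_sub_le _ _).trans ?_
      rw [norm_mul, norm_mul, norm_su2Quat, norm_su2Quat, norm_su2Quat, norm_su2Quat]; norm_num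
    nlinarith [norm_nonneg (su2Quat (U e) * su2Quat (g (e.1.shift e.2)) - su2Quat (g e.1) * su2Quat (V e))]
  calc ∑ e : Edge 3 L, ‖su2Quat (U e) * su2Quat (g (e.1.shift e.2)) - su2Quat (g e.1) * su2Quat (V e)‖ ^ 2 ≤ ∑ _e : Edge 3 L, (4 : ℝ) :=
        Finset.sum_le_sum fun e _ => h e
    _ = 4 * Fintype.card (Edge 3 L) := by rw [Finset.sum_const, Finset.card_univ, nsmul_eq_mul, mul_comm]

/-- ★★ **Level powers and the bounded-level set**: for `β ≥ 0`, a nonnegative profile `Ω′` supported in `‖x̂‖ ≤ R`, `j ≤ 4`,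
`T ≥ β·4|E|` and `T ≥ βR²`, and the fourth level moment integrable,
`∫ fpTriple·(level)^j ≤ ∫_{S_T} fpTriple·(level)^4` with the bounded-level set `S_T` of `RateTube.profile_moment_number`. [folklore] -/
theorem integral_levelWeight_pow_le_setIntegral_four {β ε : ℝ} (hβ : 0 ≤ β) {Ω' : LinkSpace L → ℝ} (hΩ0 : ∀ x, 0 ≤ Ω' x) {R : ℝ}
    (hΩt : ∀ v : Edge 3 L → Fin 3 → ℝ, Ω' (linkEmbed L v) ≠ 0 → v ∈ capBalancedSet L ∧ ‖linkEmbed L v‖ ≤ R) {j : ℕ} (hj : j ≤ 4) {T : ℝ}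
    (hTk : β * (4 * Fintype.card (Edge 3 L)) ≤ T) (hTR : β * R ^ 2 ≤ T)
    (hint : Integrable (fun p : (Edge 3 L → Fin 3 → ℝ) × ((Edge 3 L → Fin 3 → ℝ) × (Site 3 L → SU2)) =>
      fpTriple L β Ω' (fpWeight L ε) 1 1 p * (1 + β * kinDefect L (orthoTube L 1 p.1) (orthoTube L 1 p.2.1) p.2.2 + β * ‖linkEmbed L p.1‖ ^ 2 + β * ‖linkEmbed L p.2.1‖ ^ 2) ^ 4)
      ((orthoTransverse L).prod ((orthoTransverse L).prod (gaugeMeasure L)))) :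
    ∫ p, fpTriple L β Ω' (fpWeight L ε) 1 1 p *
        (1 + β * kinDefect L (orthoTube L 1 p.1) (orthoTube L 1 p.2.1) p.2.2 + β * ‖linkEmbed L p.1‖ ^ 2 + β * ‖linkEmbed L p.2.1‖ ^ 2) ^ j
        ∂((orthoTransverse L).prod ((orthoTransverse L).prod (gaugeMeasure L))) ≤
      ∫ p in ({p : (Edge 3 L → Fin 3 → ℝ) × ((Edge 3 L → Fin 3 → ℝ) × (Site 3 L → SU2)) | β * kinDefect L (orthoTube L 1 p.1) (orthoTube L 1 p.2.1) p.2.2 ≤ T} ∩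
          {p | β * ‖linkEmbed L p.1‖ ^ 2 ≤ T} ∩ {p | β * ‖linkEmbed L p.2.1‖ ^ 2 ≤ T} ∩
          {p | Ω' (linkEmbed L p.1) ≠ 0 ∧ Ω' (linkEmbed L p.2.1) ≠ 0 ∧ fpWeight L ε p.2.2 ≠ 0}),
        fpTriple L β Ω' (fpWeight L ε) 1 1 p * (1 + β * kinDefect L (orthoTube L 1 p.1) (orthoTube L 1 p.2.1) p.2.2 + β * ‖linkEmbed L p.1‖ ^ 2 + β * ‖linkEmbed L p.2.1‖ ^ 2) ^ 4
        ∂((orthoTransverse L).prod ((orthoTransverse L).prod (gaugeMeasure L))) := by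
  -- the integrand and its sign
  have hf0 : ∀ p : (Edge 3 L → Fin 3 → ℝ) × ((Edge 3 L → Fin 3 → ℝ) × (Site 3 L → SU2)), 0 ≤ fpTriple L β Ω' (fpWeight L ε) 1 1 p := fun p => by
    unfold fpTriple
    exact mul_nonneg (hΩ0 _) (mul_nonneg (mul_nonneg (fpWeight_mem_Icc L ε p.2.2).1 (transferKernel_pos su2Rep β _ _).le) (hΩ0 _))
  have hlev : ∀ p : (Edge 3 L → Fin 3 → ℝ) × ((Edge 3 L → Fin 3 → ℝ) × (Site 3 L → SU2)),
      1 ≤ 1 + β * kinDefect L (orthoTube L 1 p.1) (orthoTube L 1 p.2.1) p.2.2 + β * ‖linkEmbed L p.1‖ ^ 2 + β * ‖linkEmbed L p.2.1‖ ^ 2 := fun p => by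
    have := kinDefect_nonneg (L := L) (orthoTube L 1 p.1) (orthoTube L 1 p.2.1) p.2.2
    nlinarith [mul_nonneg hβ this, mul_nonneg hβ (sq_nonneg ‖linkEmbed L p.1‖), mul_nonneg hβ (sq_nonneg ‖linkEmbed L p.2.1‖)]
  -- Step 1: `(level)^j ≤ (level)^4`
  have step1 : ∫ p, fpTriple L β Ω' (fpWeight L ε) 1 1 p *
      (1 + β * kinDefect L (orthoTube L 1 p.1) (orthoTube L 1 p.2.1) p.2.2 + β * ‖linkEmbed L p.1‖ ^ 2 + β * ‖linkEmbed L p.2.1‖ ^ 2) ^ j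
      ∂((orthoTransverse L).prod ((orthoTransverse L).prod (gaugeMeasure L))) ≤
      ∫ p, fpTriple L β Ω' (fpWeight L ε) 1 1 p *
      (1 + β * kinDefect L (orthoTube L 1 p.1) (orthoTube L 1 p.2.1) p.2.2 + β * ‖linkEmbed L p.1‖ ^ 2 + β * ‖linkEmbed L p.2.1‖ ^ 2) ^ 4
      ∂((orthoTransverse L).prod ((orthoTransverse L).prod (gaugeMeasure L))) :=
    integral_mono_of_nonneg (ae_of_all _ fun p => mul_nonneg (hf0 p) (pow_nonneg (zero_le_one.trans (hlev p)) j)) hint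
      (ae_of_all _ fun p => mul_le_mul_of_nonneg_left (pow_le_pow_right₀ (hlev p) hj) (hf0 p))
  refine step1.trans (le_of_eq ?_)
  -- Step 2: the integrand vanishes off the bounded-level set
  refine (setIntegral_eq_integral_of_forall_compl_eq_zero fun p hp => ?_).symm
  have hkin := kinDefect_le_four_card (L := L) (orthoTube L 1 p.1) (orthoTube L 1 p.2.1) p.2.2
  have hk : β * kinDefect L (orthoTube L 1 p.1) (orthoTube L 1 p.2.1) p.2.2 ≤ T := (mul_le_mul_of_nonneg_left hkin hβ).trans hTk
  -- which condition fails?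
  by_cases h1 : Ω' (linkEmbed L p.1) = 0
  · unfold fpTriple; rw [h1, zero_mul, zero_mul]
  by_cases h2 : Ω' (linkEmbed L p.2.1) = 0
  · unfold fpTriple; rw [h2, mul_zero, mul_zero, zero_mul]
  by_cases h3 : fpWeight L ε p.2.2 = 0
  · unfold fpTriple; rw [h3, zero_mul, zero_mul, mul_zero, zero_mul]
  exfalso; apply hp
  have hx1 : β * ‖linkEmbed L p.1‖ ^ 2 ≤ T :=
    (mul_le_mul_of_nonneg_left (pow_le_pow_left₀ (norm_nonneg _) (hΩt p.1 h1).2 2) hβ).trans hTR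
  have hx2 : β * ‖linkEmbed L p.2.1‖ ^ 2 ≤ T :=
    (mul_le_mul_of_nonneg_left (pow_le_pow_left₀ (norm_nonneg _) (hΩt p.2.1 h2).2 2) hβ).trans hTR
  exact ⟨⟨⟨hk, hx1⟩, hx2⟩, h1, h2, h3⟩

end Summit.QuantumFields.YangMills.Theorems.FemtoTransferGap.TwoLattice.ConstTube

end
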